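import Literature.Computation.Certificates.KeyedGramStreamSound
import Mathlib.Data.Real.Basic

/-!
# Gram entry streams, IV: windows, targets, the main theorem, kernel tests

Companion of `KeyedGramStream` / `…Passes` / `…Sound` in the «K-STREAM» kernel lane: the glue a
multi-file certificate uses. `GroupOK` lists the per-window group checks (one `decide +kernel` per
window file), `length_entries_windowsChunks` adds the per-window entry counts, `sum_eval_targets`
identifies the sum of the window targets with Gram part + table part, and the MAIN THEOREM
`sum_eval_targets_ge` concludes: per-window group checks and side passes, the pair pass on the
total count, key digit bounds, group shape, the twin's `PSD.IsGramCertZ` (packed rows lane), the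
margin `s·e ≤ s₂` and `0 < S` ⇒ at every point of any linearly ordered field the window targets sum
to at least the table part — to a nonnegative number for a pure Gram stream
(`tsum_eq_zero_of_allGram`). Kernel tests: a 3 × 3 block streamed in two windows end to end over
`ℝ`, and a planted wrong position table refused. [cite: BlekhermanParriloThomas2012, §3.1.4
eq. (3.12), p. 64 and Thm 3.39, p. 65]

WHAT THIS FILE IS NOT: not an emitter (certificates are produced by `certsdp.sos`); the lane's farm
timings live on the certnum STATUS bus, not in this file.
-/

namespace Literature.Computation.Certificates

namespace SOS

namespace Keyed

open PSD

section Windows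

/-- Total entry count of a window list is the sum of the window counts (each a cheap `decide`).
[cite: BlekhermanParriloThomas2012, §3.1.4 eq. (3.12), p. 64] -/
theorem length_entries_windowsChunks (c : GramCtx) :
    ∀ W : List (List (ℕ × ℕ)), (entries c (windowsChunks W)).length = (W.map fun w => (entries c w).length).sum
  | [] => rfl
  | w :: W => by
    rw [windowsChunks, entries_append, List.length_append, length_entries_windowsChunks c W, List.map_cons,
      List.sum_cons]

section Field

variable {R : Type*} [Field R]

/-- **Window list of group checks**: `GroupOK c tab [W₀, …] [T₀, …]` says
`groupCheck (terms c tab Wᵥ) Tᵥ = true` for every window (one `decide +kernel` per window file;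
length mismatch is `False`). [cite: BlekhermanParriloThomas2012, §3.1.4 eq. (3.12), p. 64] -/
def GroupOK (c : GramCtx) (tab : ℕ → ℕ × Bool × ℕ) : List (List (ℕ × ℕ)) → List STerms → Prop
  | [], [] => True
  | w :: W, T :: Ts => groupCheck (terms c tab w) T = true ∧ GroupOK c tab W Ts
  | [], _ :: _ => False
  | _ :: _, [] => False

/-- **The targets of all windows evaluate to the stream's Gram part plus its table part.**
[cite: BlekhermanParriloThomas2012, §3.1.4 eq. (3.12), p. 64] -/
theorem sum_eval_targets (x : ℕ → R) (b n : ℕ) (c : GramCtx) (tab : ℕ → ℕ × Bool × ℕ) :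
    ∀ (W : List (List (ℕ × ℕ))) (Ts : List STerms), GroupOK c tab W Ts →
      (Ts.map fun T => ZTerms.eval x b n (STerms.toZ T)).sum =
        gsum x b n c (entries c (windowsChunks W)) + (W.map fun w => tsum x b n tab (entries c w)).sum
  | [], [], _ => by simp [windowsChunks, entries, gsum]
  | [], _ :: _, h => by simp [GroupOK] at h
  | _ :: _, [], h => by simp [GroupOK] at h
  | w :: W, T :: Ts, h => by
    obtain ⟨h1, h2⟩ := h
    rw [List.map_cons, List.sum_cons, ← eval_eq_of_groupCheck x b n h1, terms, eval_termsOf,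
      sum_eval_targets x b n c tab W Ts h2, windowsChunks, entries_append, gsum_append, List.map_cons,
      List.sum_cons]
    ring

end Field

section OrderedMain

variable {R : Type*} [Field R] [LinearOrder R] [IsStrictOrderedRing R]

/-- **Main theorem of the Gram entry stream lane (windowed form).** Per-window group checks and
side passes, the pair pass on the total count, key digit bounds, group shape, the twin's packed
rows PSD certificate, the margin and `0 < S` give: the window targets sum, at every point, to a
NONNEGATIVE Gram part plus the table part `Σ tsum` (which the product-stream companion file
identifies with `Σ μ_j h_j + Σ g_i σ_i`; for a pure Gram stream it is `0`).
[cite: BlekhermanParriloThomas2012, Thm 3.39, p. 65; Rump1999VerifiedLargeSystems, §4 Algorithm 4.1 step 7] -/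
theorem sum_eval_targets_ge (x : ℕ → R) {b n D P m : ℕ} {c : GramCtx} {d : SideCtx}
    {tab : ℕ → ℕ × Bool × ℕ} {W : List (List (ℕ × ℕ))} {Ts : List STerms}
    {dd : Fin m → ℕ} {B : Matrix (Fin m) (Fin c.s) ℤ}
    (hgroup : GroupOK c tab W Ts) (hside : SideOK c d 0 W)
    (hP : (W.map fun w => (entries c w).length).sum = P) (hpair : pairPass c d P = true)
    (hkeys : keysOK c b D n = true) (hD : D + D < b) (hgroups : groupsOK d.R d.Mrows = true)
    (hM : PSD.IsGramCertZ (PSD.Packed.intMatrixRows c.s d.wm d.Mrows.flatten) dd B)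
    (hmargin : c.s * d.e ≤ d.s₂) (hS : 0 < d.S) :
    (W.map fun w => tsum x b n tab (entries c w)).sum ≤
      (Ts.map fun T => ZTerms.eval x b n (STerms.toZ T)).sum := by
  rw [sum_eval_targets x b n c tab W Ts hgroup]
  have hlen : (entries c (windowsChunks W)).length = P := by rw [length_entries_windowsChunks, hP]
  have h0 := gsum_nonneg_of_isGramCertZ x (sideAll_of_sideOK c d hside) (hlen ▸ hpair) hkeys hD hgroups hM
    hmargin hS
  linarith

end OrderedMain

end Windows

/-! ### Tests / usage template (kernel-checked, end to end) -/

section Tests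

/-! The Gram block `Q = [[2,−1,0],[−1,2,−1],[0,−1,2]]` (`L = 1`) on the basis `1, x₀, x₁` (keys
`0, 1, 16` in base 16, two variables), streamed in key order as TWO windows of three entries, with
the twin `M = Q` (`S = 1`, `s₂ = e = 0`; 4-bit offset digits, groups of `R = 2` rows), position
and index tables, and the window targets `2 − 2x₀ + 2x₀²` and `0·x₁ − 2x₀x₁ + 2x₁²`. -/

/-- test context: `s = 3`, 2-bit indices, 4-bit lengths, 8-bit keys `0, 1, 16` [folklore] -/
private def tC : GramCtx := ⟨3, 2, 4, 4, 8, 1048832⟩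
/-- test side data [folklore] -/
private def tD : SideCtx := ⟨2, 4, [[2170, 1959], [2680]], 4, [[784, 1056], [1280]], 8, [[2320]], [[2708]], 1, 1, 0, 0⟩
/-- no table contributions in this test [folklore] -/
private def tTab (_ : ℕ) : ℕ × Bool × ℕ := (0, true, 0)
/-- the two windows of the entry stream [folklore] -/
private def tW : List (List (ℕ × ℕ)) := [[(3, 146718462208)], [(3, 36847427616)]]
/-- the two packed targets [folklore] -/
private def tT : List STerms := [targets 8 4 [(3, 18694424019968)], targets 8 4 [(3, 4681659195408)]]

/-- the decoder reads the intended entries [folklore] -/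
example : entries tC (windowsChunks tW) = [Entry.gram 0 0 true 2, Entry.gram 0 1 false 1,
    Entry.gram 1 1 true 2, Entry.gram 0 2 true 0, Entry.gram 1 2 false 1, Entry.gram 2 2 true 2] := by decide

/-- the packed targets decode to the key-sorted group sums [folklore] -/
example : tT = [[(0, true, 2), (1, false, 2), (2, true, 2)], [(16, true, 0), (17, false, 2), (32, true, 2)]] := by
  decide

/-- per-window group checks [folklore] -/
private theorem t_group : GroupOK tC tTab tW tT :=
  ⟨by decide, by decide, trivial⟩

/-- per-window side passes (positions 0–2 and 3–5) [folklore] -/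
private theorem t_side : SideOK tC tD 0 tW :=
  ⟨by decide, by decide, trivial⟩

/-- pair pass on all 6 positions, key digit bounds, group shape [folklore] -/
private theorem t_pair : pairPass tC tD 6 = true := by decide
/-- kernel test [folklore] -/
private theorem t_keys : keysOK tC 16 1 2 = true := by decide
/-- kernel test [folklore] -/
private theorem t_groups : groupsOK tD.R tD.Mrows = true := by decide

/-- the twin (read from the packed rows) is diagonally dominant, hence an integer Gram
certificate with no factor rows [folklore] -/
private theorem t_M : PSD.IsGramCertZ (PSD.Packed.intMatrixRows tC.s tD.wm tD.Mrows.flatten)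
    (fun _ : Fin 0 => 0) (fun _ _ => 0) := by
  unfold PSD.IsGramCertZ
  decide

/-- a defect is caught: the same stream against a wrong position table (pairs `(0,1)` and `(1,1)`
swapped) fails the side pass [folklore] -/
example : sidePass tC ⟨2, 4, [[2170, 1959], [2680]], 4, [[800, 1040], [1280]], 8, [[2320]], [[2708]], 1, 1, 0, 0⟩ 0
    (windowsChunks tW) = false := by decide

/-- **End to end**: the window targets sum to a nonnegative value at every real point (here the
table part is `0`, so this is `0 ≤ (2 − 2x₀ + 2x₀²) + (−2x₀x₁ + 2x₁²)`). [folklore] -/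
example (x : ℕ → ℝ) :
    0 ≤ (tT.map fun T => ZTerms.eval x 16 2 (STerms.toZ T)).sum := by
  have h := sum_eval_targets_ge x (D := 1) t_group t_side (by decide) t_pair t_keys (by norm_num) t_groups t_M
    (by decide) (by decide)
  have hz : (tW.map fun w => tsum x 16 2 tTab (entries tC w)).sum = 0 := by
    simp [tW, tsum_eq_zero_of_allGram x 16 2 tTab _ (by decide : allGram (entries tC [(3, 146718462208)]) = true),
      tsum_eq_zero_of_allGram x 16 2 tTab _ (by decide : allGram (entries tC [(3, 36847427616)]) = true)]
  linarith

end Tests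

end Keyed

end SOS

end Literature.Computation.Certificates
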